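import Mathlib
import Literature.MathematicalPhysics.StatisticalMechanics.LennardJonesClusters
import Summits.AtomisticToContinuum.Crystallization.Theorems.PricedLinkCensusStackingHingeFarTail
import Summits.AtomisticToContinuum.Crystallization.Theorems.PhononStability.Negative.Mirror

/-!
# Site energies of two-way matched windows are close

Let `y : Fin N → ℝ³` and `y' : Fin N' → ℝ³` be `δ₀`-separated configurations (`0 < δ₀ ≤ 1`),
`i`, `i'` two sites and `g` a rigid motion of `ℝ³` with `g (y i) = y' i'`. Suppose the windows
of radius `ℓ ≥ 2` about `y i` and `y' i'` are *two-way `θ`-matched* (`0 < θ ≤ δ₀ / 4`): every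
`y j` with `|y i - y j| ≤ ℓ` has some `y' j'` within `θ` of `g (y j)`, and every `y' j'` with
`|y' i' - y' j'| ≤ ℓ` is within `θ` of some `g (y j)`. Then the Lennard-Jones site energies
satisfy `|𝓔ⁱ(y) - 𝓔^{i'}(y')| ≤ C(δ₀) (θ + ℓ⁻³)` (`stub_siteEnergyNearMatched`).

Proof. The matching `j ↦ m j` is injective on the ball `|y i - y j| ≤ ℓ` and avoids `i'`
(separation, `2θ < δ₀`), and `| |y' i' - y' (m j)| - |y i - y j| | ≤ θ` since `g` is an
isometry. Split `𝓔ⁱ(y)` into the sum over `S = {j ≠ i : |y i - y j| ≤ ℓ - θ}` and the rest, and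
`𝓔^{i'}(y')` into the sum over `m(S)` and the rest. The matched sums differ by
`≤ (δ₀⁻⁷ + δ₀⁻¹) θ ∑ (|y i - y j|⁻⁶ + |y' i' - y' (m j)|⁻⁶) ≤ 500 (δ₀⁻⁷ + δ₀⁻¹) δ₀⁻⁶ θ` by the
mean value theorem (`|V_LJ'(t)| ≤ (δ₀⁻⁷ + δ₀⁻¹) t⁻⁶` for `t ≥ δ₀`, with
`PhononStabilityNegative.hasDerivAt_lennardJones`) and the shell sum
`sum_inv_pow_six_le`. Both remainders only involve distances `≥ ℓ/2 ≥ 1` (for `y'`: an unmatched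
`j'` with `|y' i' - y' j'| ≤ ℓ - 2θ` would be matched back into `S` and then equal some `m j`),
where `|V_LJ(r)| ≤ r⁻⁶`, so each is `≤ 8 C_tail ℓ⁻³` by the far-tail bound
`PricedHcpWindowsFarTail.stub_farTail` at range `ℓ / 2`.
-/

namespace Summit.AtomisticToContinuum.Crystallization.Theorems.PricedHcpWindowsSiteEnergyContinuity

open Filter Topology
open Literature.MathematicalPhysics.StatisticalMechanics
open PhononStabilityNegative (hasDerivAt_lennardJones)

/-! ## The Lennard-Jones potential is Lipschitz on `[δ₀, ∞)` with a summable constant -/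

/-- `|V_LJ'(t)| ≤ (δ₀⁻⁷ + δ₀⁻¹) t⁻⁶` for `t ≥ δ₀ > 0`
(`|V'(t)| ≤ t⁻¹³ + t⁻⁷ = (t⁻⁷ + t⁻¹) t⁻⁶`). [folklore] -/
theorem abs_deriv_lennardJones_le {δ₀ t : ℝ} (hδ₀ : 0 < δ₀) (ht : δ₀ ≤ t) :
    |deriv lennardJones t| ≤ (δ₀⁻¹ ^ 7 + δ₀⁻¹) * t⁻¹ ^ 6 := by
  have ht0 : 0 < t := hδ₀.trans_le ht
  rw [(hasDerivAt_lennardJones ht0.ne').deriv]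
  have hi : t⁻¹ ≤ δ₀⁻¹ := inv_anti₀ hδ₀ ht
  have hi0 : 0 ≤ t⁻¹ := inv_nonneg.2 ht0.le
  have h7 : t⁻¹ ^ 7 ≤ δ₀⁻¹ ^ 7 := pow_le_pow_left₀ hi0 hi 7
  have h6 : 0 ≤ t⁻¹ ^ 6 := pow_nonneg hi0 6
  have hA : 0 ≤ t⁻¹ ^ 13 := pow_nonneg hi0 13
  have hB : 0 ≤ t⁻¹ ^ 7 := pow_nonneg hi0 7
  calc |-(t⁻¹) ^ 13 + t⁻¹ ^ 7| ≤ t⁻¹ ^ 13 + t⁻¹ ^ 7 := abs_le.2 ⟨by linarith, by linarith⟩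
    _ = (t⁻¹ ^ 7 + t⁻¹) * t⁻¹ ^ 6 := by ring
    _ ≤ (δ₀⁻¹ ^ 7 + δ₀⁻¹) * t⁻¹ ^ 6 := mul_le_mul_of_nonneg_right (add_le_add h7 hi) h6

/-- Mean value bound: for `a, b ≥ δ₀ > 0`,
`|V_LJ(a) - V_LJ(b)| ≤ (δ₀⁻⁷ + δ₀⁻¹) (a⁻⁶ + b⁻⁶) |a - b|`. [folklore] -/
theorem abs_lennardJones_sub_le {δ₀ a b : ℝ} (hδ₀ : 0 < δ₀) (ha : δ₀ ≤ a) (hb : δ₀ ≤ b) :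
    |lennardJones a - lennardJones b| ≤
      (δ₀⁻¹ ^ 7 + δ₀⁻¹) * (a⁻¹ ^ 6 + b⁻¹ ^ 6) * |a - b| := by
  -- adapted from Summits/…/Theorems/ChessboardParticlePlanesLaminarPeriodisation.lean
  have hK0 : 0 ≤ δ₀⁻¹ ^ 7 + δ₀⁻¹ := by positivity
  set m := min a b with hm
  have hmδ : δ₀ ≤ m := le_min ha hb
  have hm0 : 0 < m := hδ₀.trans_le hmδ
  have hdiff : ∀ x ∈ Set.Ici m, DifferentiableAt ℝ lennardJones x := fun x hx =>
    (hasDerivAt_lennardJones (hm0.trans_le (Set.mem_Ici.1 hx)).ne').differentiableAt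
  have hbound : ∀ x ∈ Set.Ici m, ‖deriv lennardJones x‖ ≤ (δ₀⁻¹ ^ 7 + δ₀⁻¹) * m⁻¹ ^ 6 := by
    intro x hx
    have hx' : m ≤ x := Set.mem_Ici.1 hx
    rw [Real.norm_eq_abs]
    refine (abs_deriv_lennardJones_le hδ₀ (hmδ.trans hx')).trans ?_
    have : x⁻¹ ^ 6 ≤ m⁻¹ ^ 6 :=
      pow_le_pow_left₀ (inv_nonneg.2 (hm0.le.trans hx')) (inv_anti₀ hm0 hx') 6
    exact mul_le_mul_of_nonneg_left this hK0
  have hmvt := (convex_Ici m).norm_image_sub_le_of_norm_deriv_le hdiff hbound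
    (Set.mem_Ici.2 (min_le_right a b)) (Set.mem_Ici.2 (min_le_left a b))
  rw [Real.norm_eq_abs, Real.norm_eq_abs] at hmvt
  have hmin : m⁻¹ ^ 6 ≤ a⁻¹ ^ 6 + b⁻¹ ^ 6 := by
    have ha6 : 0 ≤ a⁻¹ ^ 6 := pow_nonneg (inv_nonneg.2 (hδ₀.le.trans ha)) 6
    have hb6 : 0 ≤ b⁻¹ ^ 6 := pow_nonneg (inv_nonneg.2 (hδ₀.le.trans hb)) 6
    rcases min_choice a b with h | h
    · rw [hm, h]; linarith
    · rw [hm, h]; linarith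
  calc |lennardJones a - lennardJones b| ≤ (δ₀⁻¹ ^ 7 + δ₀⁻¹) * m⁻¹ ^ 6 * |a - b| := hmvt
    _ ≤ (δ₀⁻¹ ^ 7 + δ₀⁻¹) * (a⁻¹ ^ 6 + b⁻¹ ^ 6) * |a - b| :=
        mul_le_mul_of_nonneg_right (mul_le_mul_of_nonneg_left hmin hK0) (abs_nonneg _)

/-- The far field: `|V_LJ(r)| ≤ r⁻⁶` for `r ≥ 1` (`-(1/6) r⁻⁶ ≤ V_LJ(r) ≤ 0`). [folklore] -/
theorem abs_lennardJones_le_of_one_le {r : ℝ} (hr : 1 ≤ r) : |lennardJones r| ≤ r⁻¹ ^ 6 := by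
  have h0 : 0 < r := one_pos.trans_le hr
  have hup := lennardJones_nonpos hr
  have hlow := neg_le_lennardJones_of_le h0 le_rfl
  have h6 : 0 ≤ r⁻¹ ^ 6 := pow_nonneg (inv_nonneg.2 h0.le) 6
  rw [abs_le]
  constructor <;> linarith

/-- `|a + (b - c)| ≤ |a| + |b| + |c|`. [folklore] -/
theorem abs_add_sub_le_three (a b c : ℝ) : |a + (b - c)| ≤ |a| + |b| + |c| := by
  have ha := neg_abs_le a
  have ha' := le_abs_self a
  have hb := neg_abs_le b
  have hb' := le_abs_self b
  have hc := neg_abs_le c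
  have hc' := le_abs_self c
  rw [abs_le]
  constructor <;> linarith

/-! ## The continuity estimate -/

/-- **Site energies of two-way matched windows are close.** For `0 < δ₀ ≤ 1` there is `C ≥ 0`
such that for all `ℓ ≥ 2`, `0 < θ ≤ δ₀/4`, all `δ₀`-separated configurations `y : Fin N → ℝ³`,
`y' : Fin N' → ℝ³`, sites `i`, `i'` and rigid motions `g` with `g (y i) = y' i'`: if every `y j`
with `|y i - y j| ≤ ℓ` has some `y' j'` within `θ` of `g (y j)`, and every `y' j'` with
`|y' i' - y' j'| ≤ ℓ` is within `θ` of some `g (y j)`, then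
`|𝓔ⁱ_LJ(y) - 𝓔^{i'}_LJ(y')| ≤ C (θ + ℓ⁻³)`. The matching is injective near `i` and moves
distances to the centre by `≤ θ` (mean value theorem and the shell sum `sum_inv_pow_six_le` for
the matched part); unmatched sites on either side are at distance `≥ ℓ/2` from the centre
(far-tail bound `PricedHcpWindowsFarTail.stub_farTail`). [folklore] -/
theorem stub_siteEnergyNearMatched : ∀ δ₀ : ℝ, 0 < δ₀ → δ₀ ≤ 1 → ∃ C : ℝ, 0 ≤ C ∧ ∀ (ℓ θ : ℝ), 2 ≤ ℓ → 0 < θ → θ ≤ δ₀ / 4 → ∀ (N : ℕ) (y : Fin N → EuclideanSpace ℝ (Fin 3)) (N' : ℕ) (y' : Fin N' → EuclideanSpace ℝ (Fin 3)), (∀ i j : Fin N, i ≠ j → δ₀ ≤ dist (y i) (y j)) → (∀ i j : Fin N', i ≠ j → δ₀ ≤ dist (y' i) (y' j)) → ∀ (i : Fin N) (i' : Fin N') (g : EuclideanSpace ℝ (Fin 3) ≃ᵃⁱ[ℝ] EuclideanSpace ℝ (Fin 3)), g (y i) = y' i' → (∀ j : Fin N, dist (y i) (y j) ≤ ℓ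 → ∃ j' : Fin N', dist (y' j') (g (y j)) ≤ θ) → (∀ j' : Fin N', dist (y' i') (y' j') ≤ ℓ → ∃ j : Fin N, dist (y' j') (g (y j)) ≤ θ) → |Literature.MathematicalPhysics.StatisticalMechanics.siteEnergy Literature.MathematicalPhysics.StatisticalMechanics.lennardJones y i - Literature.MathematicalPhysics.StatisticalMechanics.siteEnergy Literature.MathematicalPhysics.StatisticalMechanics.lennardJones y' i'| ≤ C * (θ + ℓ⁻¹ ^ 3) := by
  intro δ₀ hδ₀ hδ₁
  obtain ⟨CT, hCT0, hCT⟩ := PricedHcpWindowsFarTail.stub_farTail δ₀ hδ₀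
  refine ⟨500 * (δ₀⁻¹ ^ 7 + δ₀⁻¹) * δ₀⁻¹ ^ 6 + 16 * CT, by positivity, ?_⟩
  intro ℓ θ hℓ hθ hθδ N y N' y' hsep hsep' i i' g hgi h1 h2
  have hθδ' : θ < δ₀ := by linarith
  have hδℓ : δ₀ ≤ ℓ / 2 := by linarith
  -- `g` is an isometry
  have hg : ∀ a b, dist (g a) (g b) = dist a b := fun a b => g.dist_map a b
  -- the matching map `m`
  have h1' : ∀ j : Fin N, ∃ j' : Fin N',
      dist (y i) (y j) ≤ ℓ → dist (y' j') (g (y j)) ≤ θ := by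
    intro j
    by_cases h : dist (y i) (y j) ≤ ℓ
    · obtain ⟨j', hj'⟩ := h1 j h
      exact ⟨j', fun _ => hj'⟩
    · exact ⟨i', fun h' => absurd h' h⟩
  choose m hm using h1'
  -- matched points have almost the same distance to the centre
  have hcomp : ∀ (j : Fin N) (j' : Fin N'), dist (y' j') (g (y j)) ≤ θ →
      |dist (y' i') (y' j') - dist (y i) (y j)| ≤ θ := by
    intro j j' hjj'
    rw [← hg (y i) (y j), hgi, dist_comm (y' i') (y' j'), dist_comm (y' i') (g (y j))]
    exact (abs_dist_sub_le (y' j') (g (y j)) (y' i')).trans hjj'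
  -- matched partners are not the centre `i'`
  have hmi : ∀ j, j ≠ i → dist (y i) (y j) ≤ ℓ → m j ≠ i' := by
    intro j hji hjℓ hcontra
    have h := hm j hjℓ
    rw [hcontra, ← hgi, hg] at h
    have := hsep i j hji.symm
    linarith
  -- the matching is injective on the `ℓ`-ball
  have hminj : ∀ j k, dist (y i) (y j) ≤ ℓ → dist (y i) (y k) ≤ ℓ → m j = m k → j = k := by
    intro j k hj hk hjk
    by_contra hne
    have h := hsep j k hne
    have hj' := hm j hj
    have hk' := hm k hk
    rw [hjk, dist_comm] at hj'
    have htri : dist (g (y j)) (g (y k)) ≤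
        dist (g (y j)) (y' (m k)) + dist (y' (m k)) (g (y k)) := dist_triangle _ _ _
    rw [hg (y j) (y k)] at htri
    linarith
  -- the matched index set `S` and the two remainders `R`, `R'`
  obtain ⟨S, hS_def⟩ : ∃ S : Finset (Fin N),
      S = (Finset.univ.erase i).filter (fun j => dist (y i) (y j) ≤ ℓ - θ) := ⟨_, rfl⟩
  obtain ⟨R, hR_def⟩ : ∃ R : Finset (Fin N),
      R = (Finset.univ.erase i).filter (fun j => ¬ dist (y i) (y j) ≤ ℓ - θ) := ⟨_, rfl⟩
  have hS : ∀ j ∈ S, j ≠ i ∧ dist (y i) (y j) ≤ ℓ := fun j hj => by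
    rw [hS_def] at hj
    obtain ⟨hj1, hj2⟩ := Finset.mem_filter.1 hj
    exact ⟨Finset.ne_of_mem_erase hj1, by linarith⟩
  have hSinj : Set.InjOn m S := fun j hj k hk hjk =>
    hminj j k (hS j hj).2 (hS k hk).2 hjk
  have hSsub : S.image m ⊆ Finset.univ.erase i' := by
    intro j' hj'
    obtain ⟨j, hj, rfl⟩ := Finset.mem_image.1 hj'
    exact Finset.mem_erase.2 ⟨hmi j (hS j hj).1 (hS j hj).2, Finset.mem_univ _⟩
  obtain ⟨R', hR'_def⟩ : ∃ R' : Finset (Fin N'),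
      R' = Finset.univ.erase i' \ S.image m := ⟨_, rfl⟩
  -- decomposition of the two site energies
  have hE : siteEnergy lennardJones y i =
      ∑ j ∈ S, lennardJones (dist (y i) (y j)) +
        ∑ j ∈ R, lennardJones (dist (y i) (y j)) := by
    unfold siteEnergy
    rw [hS_def, hR_def]
    exact (Finset.sum_filter_add_sum_filter_not _ _ _).symm
  have hE' : siteEnergy lennardJones y' i' =
      ∑ j ∈ S, lennardJones (dist (y' i') (y' (m j))) +
        ∑ j' ∈ R', lennardJones (dist (y' i') (y' j')) := by
    unfold siteEnergy
    rw [hR'_def, ← Finset.sum_sdiff hSsub, Finset.sum_image hSinj, add_comm]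
  -- (A) the matched part
  have hA : ∀ j ∈ S,
      |lennardJones (dist (y i) (y j)) - lennardJones (dist (y' i') (y' (m j)))| ≤
        (δ₀⁻¹ ^ 7 + δ₀⁻¹) * θ *
          ((dist (y i) (y j))⁻¹ ^ 6 + (dist (y' i') (y' (m j)))⁻¹ ^ 6) := by
    intro j hj
    obtain ⟨hji, hjℓ⟩ := hS j hj
    have ha : δ₀ ≤ dist (y i) (y j) := hsep i j hji.symm
    have hb : δ₀ ≤ dist (y' i') (y' (m j)) := hsep' i' (m j) (hmi j hji hjℓ).symm
    have hd : |dist (y i) (y j) - dist (y' i') (y' (m j))| ≤ θ := by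
      rw [abs_sub_comm]
      exact hcomp j (m j) (hm j hjℓ)
    have h := abs_lennardJones_sub_le hδ₀ ha hb
    have hpos : 0 ≤ (δ₀⁻¹ ^ 7 + δ₀⁻¹) *
        ((dist (y i) (y j))⁻¹ ^ 6 + (dist (y' i') (y' (m j)))⁻¹ ^ 6) := by positivity
    calc _ ≤ (δ₀⁻¹ ^ 7 + δ₀⁻¹) * ((dist (y i) (y j))⁻¹ ^ 6 + (dist (y' i') (y' (m j)))⁻¹ ^ 6) *
          |dist (y i) (y j) - dist (y' i') (y' (m j))| := h
      _ ≤ (δ₀⁻¹ ^ 7 + δ₀⁻¹) * ((dist (y i) (y j))⁻¹ ^ 6 + (dist (y' i') (y' (m j)))⁻¹ ^ 6) *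
          θ := mul_le_mul_of_nonneg_left hd hpos
      _ = _ := by ring
  have hsumA : ∑ j ∈ S,
      |lennardJones (dist (y i) (y j)) - lennardJones (dist (y' i') (y' (m j)))| ≤
        (δ₀⁻¹ ^ 7 + δ₀⁻¹) * θ * (250 * δ₀⁻¹ ^ 6 + 250 * δ₀⁻¹ ^ 6) := by
    have h6 := sum_inv_pow_six_le y hδ₀ hsep i
    have h6' := sum_inv_pow_six_le y' hδ₀ hsep' i'
    have hsub1 : ∑ j ∈ S, (dist (y i) (y j))⁻¹ ^ 6 ≤
        ∑ j ∈ Finset.univ.erase i, (dist (y i) (y j))⁻¹ ^ 6 :=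
      Finset.sum_le_sum_of_subset_of_nonneg (hS_def ▸ Finset.filter_subset _ _)
        fun _ _ _ => by positivity
    have himg : ∑ j' ∈ S.image m, (dist (y' i') (y' j'))⁻¹ ^ 6 =
        ∑ j ∈ S, (dist (y' i') (y' (m j)))⁻¹ ^ 6 := Finset.sum_image hSinj
    have hsub2 : ∑ j ∈ S, (dist (y' i') (y' (m j)))⁻¹ ^ 6 ≤
        ∑ j' ∈ Finset.univ.erase i', (dist (y' i') (y' j'))⁻¹ ^ 6 := by
      rw [← himg]
      exact Finset.sum_le_sum_of_subset_of_nonneg hSsub fun _ _ _ => by positivity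
    calc _ ≤ ∑ j ∈ S, (δ₀⁻¹ ^ 7 + δ₀⁻¹) * θ *
          ((dist (y i) (y j))⁻¹ ^ 6 + (dist (y' i') (y' (m j)))⁻¹ ^ 6) := Finset.sum_le_sum hA
      _ = (δ₀⁻¹ ^ 7 + δ₀⁻¹) * θ * (∑ j ∈ S, (dist (y i) (y j))⁻¹ ^ 6 +
          ∑ j ∈ S, (dist (y' i') (y' (m j)))⁻¹ ^ 6) := by
          rw [← Finset.mul_sum, Finset.sum_add_distrib]
      _ ≤ (δ₀⁻¹ ^ 7 + δ₀⁻¹) * θ * (250 * δ₀⁻¹ ^ 6 + 250 * δ₀⁻¹ ^ 6) :=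
          mul_le_mul_of_nonneg_left (add_le_add (hsub1.trans h6) (hsub2.trans h6'))
            (by positivity)
  -- the far tail at range `ℓ / 2`, for both configurations
  have htail : ∀ (M : ℕ) (z : Fin M → EuclideanSpace ℝ (Fin 3)),
      (∀ a b : Fin M, a ≠ b → δ₀ ≤ dist (z a) (z b)) → ∀ a : Fin M,
      ∑ b ∈ (Finset.univ.erase a).filter (fun b => ℓ / 2 ≤ dist (z a) (z b)),
        (dist (z a) (z b))⁻¹ ^ 6 ≤ 8 * CT * ℓ⁻¹ ^ 3 := by
    intro M z hz a
    have h := hCT M z hz a (ℓ / 2) hδℓ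
    have e : (ℓ / 2)⁻¹ ^ 3 = 8 * ℓ⁻¹ ^ 3 := by
      rw [inv_div, div_eq_mul_inv]
      ring
    rw [e] at h
    exact h.trans_eq (by ring)
  -- (B) the remainder in `y`
  have hsumB : ∑ j ∈ R, |lennardJones (dist (y i) (y j))| ≤ 8 * CT * ℓ⁻¹ ^ 3 := by
    have hRfar : ∀ j ∈ R, ℓ - θ < dist (y i) (y j) := fun j hj => by
      rw [hR_def] at hj
      exact not_le.1 (Finset.mem_filter.1 hj).2
    have hRsub : R ⊆ (Finset.univ.erase i).filter (fun j => ℓ / 2 ≤ dist (y i) (y j)) := by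
      intro j hj
      have hfar := hRfar j hj
      rw [hR_def] at hj
      exact Finset.mem_filter.2 ⟨(Finset.mem_filter.1 hj).1, by linarith⟩
    calc ∑ j ∈ R, |lennardJones (dist (y i) (y j))| ≤ ∑ j ∈ R, (dist (y i) (y j))⁻¹ ^ 6 :=
          Finset.sum_le_sum fun j hj =>
            abs_lennardJones_le_of_one_le (by linarith [hRfar j hj])
      _ ≤ ∑ j ∈ (Finset.univ.erase i).filter (fun j => ℓ / 2 ≤ dist (y i) (y j)),
            (dist (y i) (y j))⁻¹ ^ 6 :=
          Finset.sum_le_sum_of_subset_of_nonneg hRsub fun _ _ _ => by positivity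
      _ ≤ 8 * CT * ℓ⁻¹ ^ 3 := htail N y hsep i
  -- (C) the remainder in `y'`: unmatched sites are far from the centre
  have hR'far : ∀ j' ∈ R', ℓ - 2 * θ < dist (y' i') (y' j') := by
    intro j' hj'
    rw [hR'_def] at hj'
    obtain ⟨hj'1, hj'2⟩ := Finset.mem_sdiff.1 hj'
    have hj'i : j' ≠ i' := Finset.ne_of_mem_erase hj'1
    by_contra hle
    obtain ⟨j, hj⟩ := h2 j' (by linarith [not_lt.1 hle])
    have hji : j ≠ i := by
      intro hji
      rw [hji, hgi] at hj
      have := hsep' j' i' hj'i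
      linarith
    have hc := hcomp j j' hj
    have hij : dist (y i) (y j) ≤ ℓ - θ := by
      rw [abs_le] at hc
      linarith [not_lt.1 hle, hc.1]
    have hjS : j ∈ S :=
      hS_def ▸ Finset.mem_filter.2 ⟨Finset.mem_erase.2 ⟨hji, Finset.mem_univ _⟩, hij⟩
    have hmj := hm j (by linarith)
    have hmj' : m j = j' := by
      by_contra hne
      have hfar := hsep' (m j) j' hne
      have htri : dist (y' (m j)) (y' j') ≤
          dist (y' (m j)) (g (y j)) + dist (g (y j)) (y' j') := dist_triangle _ _ _
      rw [dist_comm (g (y j)) (y' j')] at htri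
      linarith
    exact hj'2 (Finset.mem_image.2 ⟨j, hjS, hmj'⟩)
  have hsumC : ∑ j' ∈ R', |lennardJones (dist (y' i') (y' j'))| ≤ 8 * CT * ℓ⁻¹ ^ 3 := by
    have hRsub : R' ⊆ (Finset.univ.erase i').filter (fun j' => ℓ / 2 ≤ dist (y' i') (y' j')) := by
      intro j' hj'
      have hfar := hR'far j' hj'
      rw [hR'_def] at hj'
      exact Finset.mem_filter.2 ⟨(Finset.mem_sdiff.1 hj').1, by linarith⟩
    calc ∑ j' ∈ R', |lennardJones (dist (y' i') (y' j'))|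
        ≤ ∑ j' ∈ R', (dist (y' i') (y' j'))⁻¹ ^ 6 :=
          Finset.sum_le_sum fun j' hj' =>
            abs_lennardJones_le_of_one_le (by linarith [hR'far j' hj'])
      _ ≤ ∑ j' ∈ (Finset.univ.erase i').filter (fun j' => ℓ / 2 ≤ dist (y' i') (y' j')),
            (dist (y' i') (y' j'))⁻¹ ^ 6 :=
          Finset.sum_le_sum_of_subset_of_nonneg hRsub fun _ _ _ => by positivity
      _ ≤ 8 * CT * ℓ⁻¹ ^ 3 := htail N' y' hsep' i'
  -- assembly
  have hdiff : siteEnergy lennardJones y i - siteEnergy lennardJones y' i' =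
      ∑ j ∈ S, (lennardJones (dist (y i) (y j)) - lennardJones (dist (y' i') (y' (m j)))) +
        (∑ j ∈ R, lennardJones (dist (y i) (y j)) -
          ∑ j' ∈ R', lennardJones (dist (y' i') (y' j'))) := by
    rw [hE, hE', Finset.sum_sub_distrib]
    ring
  have hx1 := (Finset.abs_sum_le_sum_abs _ _).trans hsumA
  have hx2 := (Finset.abs_sum_le_sum_abs _ _).trans hsumB
  have hx3 := (Finset.abs_sum_le_sum_abs _ _).trans hsumC
  rw [hdiff]
  refine (abs_add_sub_le_three _ _ _).trans ?_
  have hKn : 0 ≤ 500 * (δ₀⁻¹ ^ 7 + δ₀⁻¹) * δ₀⁻¹ ^ 6 * ℓ⁻¹ ^ 3 := by positivity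
  have hCn : 0 ≤ 16 * CT * θ := mul_nonneg (mul_nonneg (by norm_num) hCT0) hθ.le
  linarith

end Summit.AtomisticToContinuum.Crystallization.Theorems.PricedHcpWindowsSiteEnergyContinuity
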